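import Mathlib
import Summits.NavierStokesRegularity.NavierStokesRegularity.Theorems.FilamentSkeletonRssStadiumStripPropagationQuarter
import Summits.NavierStokesRegularity.NavierStokesRegularity.Theorems.FilamentSkeletonRssStadiumGlue
import Summits.NavierStokesRegularity.NavierStokesRegularity.Theorems.FilamentSkeletonRssStadiumCentreReflection
import Summits.NavierStokesRegularity.NavierStokesRegularity.Theorems.FilamentSkeletonRssStadiumParameterReversal

/-!
# Route `FilamentSkeletonRss` · twin child cruxes `TangentSkeletonNearStraight` (stmt-28295) / `TangentSkeletonNearStraightL` (stmt-23320) ·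
# shared registered stub `stub_stripPropagation : StripPropagation` — THE REGISTERED STUB FROM A RIGHT-HALF QUARTER-WIDTH CORE («WLOG the near end is
# the right end», BY NAME)

Capstone of this hand's bricks.  `Theorems.StadiumStripPropagationQuarter.stripPropagation_of_quarterCore` (p830097) reduces the registered stub to a
quarter-width per-filament core with template bound; the corner certificates of the quarter programme (hands leafhand-15) are written for targets in the
RIGHT half of the output stadium (`cc ≤ x₀`).  Here the core is reduced further to targets with `Re z > c_j − cs√Γ/4` ONLY (`stripPropagation_of_rightHalfCore`):
for the left half one reverses the parametrisation of filament `j` about its centre and flips its circulation — the stub's hypotheses are invariant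
(`Theorems.StadiumParameterReversal` §4, `Theorems.StadiumCentreReflection` for the stadium continuations), the Biot–Savart field is unchanged and the target
function is reflected (`biotSavart_field_reversal`, `biotSavart_target_reversal`), so the right-half core of the reversed datum, composed with `w ↦ 2c_j − w`,
is a left-half continuation of the original target function; the two halves are glued along the real trace (`Theorems.StadiumGlue.glue_stadium_halves`).
So the by-name closer of either twin is `stub_stripPropagation := stripPropagation_of_rightHalfCore ⟨right-half core⟩`.
HONEST FRAMING: bookkeeping for a HYPOTHETICAL filament skeleton on the NEGATIVE side of a MODEL route; the right-half quarter-width core is NOT proved here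
(it is the open analytic content of the stub), so no stub of 28295 / 23320 is closed; nothing here bears on Navier–Stokes regularity or blow-up.
`--supports stmt-NavierStokesRegularity-28295`.
-/

set_option linter.dupNamespace false

noncomputable section

namespace Summit.NavierStokesRegularity.NavierStokesRegularity.Theorems.StadiumStripPropagationRightHalf

open Set MeasureTheory Complex
open scoped InnerProductSpace
open Literature.Analysis.FluidPDE
open Summit.NavierStokesRegularity.NavierStokesRegularity.Theorems.AnalyticStripStadium
open Summit.NavierStokesRegularity.NavierStokesRegularity.Theorems.StadiumStripPropagationQuarter
open Summit.NavierStokesRegularity.NavierStokesRegularity.Theorems.StadiumGlue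
open Summit.NavierStokesRegularity.NavierStokesRegularity.Theorems.StadiumCentreReflection
open Summit.NavierStokesRegularity.NavierStokesRegularity.Theorems.StadiumParameterReversal

/-- The coefficient sum is blind to the sign flip of one circulation. [folklore] -/
theorem coeff_sum_update_neg {N : ℕ} (Γ : ℝ) (γ : Fin N → ℝ) (j : Fin N) :
    ∑ k, |Γ * (Function.update γ j (-γ j)) k / (4 * Real.pi)| = ∑ k, |Γ * γ k / (4 * Real.pi)| := by
  refine Finset.sum_congr rfl fun k _ => ?_
  by_cases hk : k = j
  · subst hk
    rw [Function.update_self, mul_neg, neg_div, abs_neg]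
  · rw [Function.update_of_ne hk]

/-- The reflection `w ↦ 2cc − w` maps the LEFT half `{Re w < cc + δ}` of a stadium centred at `cc` into its RIGHT half `{cc − δ < Re}`. [folklore] -/
theorem reflect_left_mem_right {h R cc δ : ℝ} {w : ℂ} (hw : w ∈ {z : ℂ | (|z.im| < h ∧ |z.re - cc| < R) ∧ z.re < cc + δ}) :
    (2 * (cc : ℂ) - w) ∈ {z : ℂ | (|z.im| < h ∧ |z.re - cc| < R) ∧ cc - δ < z.re} := by
  obtain ⟨⟨h1, h2⟩, h3⟩ := hw
  refine ⟨⟨?_, ?_⟩, ?_⟩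
  · simpa using h1
  · have : (2 * (cc : ℂ) - w).re - cc = -(w.re - cc) := by simp; ring
    rw [this, abs_neg]; exact h2
  · have : (2 * (cc : ℂ) - w).re = 2 * cc - w.re := by simp
    rw [this]; linarith

/-- **`StripPropagation` from a RIGHT-HALF quarter-width per-filament core (template form).**  HYPOTHESIS `rcore`: as the hypothesis `core` of
`stripPropagation_of_quarterCore`, except that the continuation is only required on the right half `{Re z > c j − cs√Γ/4}` of the quarter stadium.
CONCLUSION: the registered stub statement (Theorems-side verbatim copy). [folklore] -/
theorem stripPropagation_of_rightHalfCore
    (rcore : ∀ (N : ℕ) (ρ K Λ Rb cg θ₀ KA cs : ℝ), 0 < N → 0 < ρ → 0 < Λ → 0 < Rb → Rb ≤ 1/2 → 0 < cg → 0 < θ₀ → 0 < KA →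
      0 < cs → 8 * cs ≤ ρ →
      ∃ (A h₀ L₀ : ℝ), ∀ Γ : ℝ, 1 ≤ Γ → 1 ≤ Real.log Γ → h₀ ≤ cs * √Γ / 4 → L₀ ≤ Rb * √(Γ * Real.log Γ) →
      ∀ (γ : Fin N → ℝ) (X : Fin N → ℝ → EuclideanSpace ℝ (Fin 3)) (c : Fin N → ℝ) (Aa : Fin N → ℝ → ℝ)
        (u : (Fin N → ℝ → EuclideanSpace ℝ (Fin 3)) → EuclideanSpace ℝ (Fin 3) → EuclideanSpace ℝ (Fin 3)),
        (∀ Z y, u Z y = ∑ k, (Γ*γ k/(4*Real.pi))•∫ σ:ℝ, ((‖y-Z k σ‖^2+Real.exp (-(1+Real.eulerMascheroniConstant-Real.log 2))*Aa k σ)^(3/2:ℝ))⁻¹•cross (deriv (Z k) σ) (y-Z k σ)) →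
        (∀ j, |γ j| ≤ θ₀⁻¹) →
        (∀ j, ContDiff ℝ 2 (X j) ∧ (∀ τ, ‖deriv (X j) τ‖ = 1) ∧ (∀ τ, ‖iteratedDeriv 2 (X j) τ‖ * √Γ ≤ K) ∧
          ∀ τ σ, ‖deriv (X j) τ - deriv (X j) σ‖ ≤ Rb) →
        (∀ j k, j ≠ k → ∀ τ σ, ρ * √Γ ≤ ‖X j τ - X k σ‖) →
        (∀ j τ σ, ρ * √Γ ≤ |τ - σ| → cg * ρ * √Γ ≤ ‖X j τ - X j σ‖) →
        (∀ j, Differentiable ℝ (Aa j) ∧ (∀ τ, Λ⁻¹ ≤ Aa j τ) ∧ ∀ τ, Aa j τ ≤ KA * (1 + Γ + ‖X j τ‖ ^ 2)) →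
        (∀ j, ∃ F : ℂ → (Fin 3 → ℂ),
          DifferentiableOn ℂ F {z : ℂ | |z.im| < cs * √Γ ∧ |z.re - c j| < Rb * √(Γ * Real.log Γ) + cs * √Γ} ∧
          (∀ t : ℝ, (t : ℂ) ∈ {z : ℂ | |z.im| < cs * √Γ ∧ |z.re - c j| < Rb * √(Γ * Real.log Γ) + cs * √Γ} →
            F t = fun i => ((⟪X j t, EuclideanSpace.single i (1:ℝ)⟫_ℝ : ℝ) : ℂ)) ∧
          ∀ z ∈ {z : ℂ | |z.im| < cs * √Γ ∧ |z.re - c j| < Rb * √(Γ * Real.log Γ) + cs * √Γ}, ‖deriv F z‖ ≤ 2) →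
        (∀ j, ∃ G : ℂ → ℂ,
          DifferentiableOn ℂ G {z : ℂ | |z.im| < cs * √Γ ∧ |z.re - c j| < Rb * √(Γ * Real.log Γ) + cs * √Γ} ∧
          (∀ t : ℝ, (t : ℂ) ∈ {z : ℂ | |z.im| < cs * √Γ ∧ |z.re - c j| < Rb * √(Γ * Real.log Γ) + cs * √Γ} →
            G t = ((Aa j t : ℝ) : ℂ)) ∧
          ∀ z ∈ {z : ℂ | |z.im| < cs * √Γ ∧ |z.re - c j| < Rb * √(Γ * Real.log Γ) + cs * √Γ},
            Aa j z.re / 2 ≤ (G z).re ∧ ‖G z‖ ≤ 2 * Aa j z.re) →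
        ∀ j, ∃ U : ℂ → (Fin 3 → ℂ),
          DifferentiableOn ℂ U {z : ℂ | (|z.im| < cs * √Γ / 4 ∧ |z.re - c j| < Rb * √(Γ * Real.log Γ) + cs * √Γ / 4) ∧ c j - cs * √Γ / 4 < z.re} ∧
          (∀ t : ℝ, (t : ℂ) ∈ {z : ℂ | (|z.im| < cs * √Γ / 4 ∧ |z.re - c j| < Rb * √(Γ * Real.log Γ) + cs * √Γ / 4) ∧ c j - cs * √Γ / 4 < z.re} →
            U t = fun i => ((⟪u X (X j t), EuclideanSpace.single i (1:ℝ)⟫_ℝ : ℝ) : ℂ)) ∧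
          ∀ z ∈ {z : ℂ | (|z.im| < cs * √Γ / 4 ∧ |z.re - c j| < Rb * √(Γ * Real.log Γ) + cs * √Γ / 4) ∧ c j - cs * √Γ / 4 < z.re},
            ‖U z‖ ≤ (∑ k, |Γ * γ k / (4 * Real.pi)|) * (A *
              ((1 + |Real.log (Rb * √(Γ * Real.log Γ) + cs * √Γ / 4)| +
                ((Rb * √(Γ * Real.log Γ) + cs * √Γ / 4) / (cs * √Γ / 4)) ^ 2) / (cs * √Γ / 4) + 1 / (ρ * √Γ)))) :
    StripPropagation := by
  refine stripPropagation_of_quarterCore ?_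
  intro N ρ K Λ Rb cg θ₀ KA cs hN hρ hΛ hRb hRb2 hcg hθ hKA hcs h8
  obtain ⟨A, h₀, L₀, hrc⟩ := rcore N ρ K Λ Rb cg θ₀ KA cs hN hρ hΛ hRb hRb2 hcg hθ hKA hcs h8
  refine ⟨A, h₀, L₀, ?_⟩
  intro Γ hΓ1 hℓ1 hh₀ hL₀ γ X c Aa u hu hγ hX hsep hca hA hF hG j
  have hΓpos : 0 < Γ := by linarith
  have hr0 : 0 < √Γ := Real.sqrt_pos.mpr hΓpos
  have hh : 0 < cs * √Γ / 4 := by positivity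
  have hLpos : 0 < Rb * √(Γ * Real.log Γ) := mul_pos hRb (Real.sqrt_pos.mpr (mul_pos hΓpos (by linarith)))
  have hhs : 0 < cs * √Γ := by positivity
  -- (1) the right half, directly
  obtain ⟨U₁, hU₁, hU₁r, hU₁B⟩ := hrc Γ hΓ1 hℓ1 hh₀ hL₀ γ X c Aa u hu hγ hX hsep hca hA hF hG j
  -- (2) the reversed datum about the centre `c j`
  set cc : ℝ := c j with hccdef
  set γ' : Fin N → ℝ := Function.update γ j (-γ j) with hγ'
  set X' : Fin N → ℝ → EuclideanSpace ℝ (Fin 3) := Function.update X j (fun s => X j (2 * cc - s)) with hX'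
  set Aa' : Fin N → ℝ → ℝ := Function.update Aa j (fun s => Aa j (2 * cc - s)) with hAa'
  set u' : (Fin N → ℝ → EuclideanSpace ℝ (Fin 3)) → EuclideanSpace ℝ (Fin 3) → EuclideanSpace ℝ (Fin 3) :=
    fun Z y => u (Function.update Z j (fun s => Z j (2 * cc - s))) y with hu'
  have hu'eq := biotSavart_field_reversal hu j (2 * cc)
  have hγ'b := reversal_gamma_bound hγ j
  have hX'h := reversal_curve_hyps hX j (2 * cc)
  have hsep' := reversal_separation hsep j (2 * cc)
  have hca' := reversal_chordArc hca j (2 * cc)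
  have hA' := reversal_area_hyps hA j (2 * cc)
  -- stadium continuations of the reversed datum (filament `j` reflected through its own centre; the others untouched)
  have hF' : ∀ k, ∃ F : ℂ → (Fin 3 → ℂ),
      DifferentiableOn ℂ F {z : ℂ | |z.im| < cs * √Γ ∧ |z.re - c k| < Rb * √(Γ * Real.log Γ) + cs * √Γ} ∧
      (∀ t : ℝ, (t : ℂ) ∈ {z : ℂ | |z.im| < cs * √Γ ∧ |z.re - c k| < Rb * √(Γ * Real.log Γ) + cs * √Γ} →
        F t = fun i => ((⟪X' k t, EuclideanSpace.single i (1:ℝ)⟫_ℝ : ℝ) : ℂ)) ∧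
      ∀ z ∈ {z : ℂ | |z.im| < cs * √Γ ∧ |z.re - c k| < Rb * √(Γ * Real.log Γ) + cs * √Γ}, ‖deriv F z‖ ≤ 2 := by
    intro k
    by_cases hk : k = j
    · subst hk
      obtain ⟨F, hF1, hF2, hF3⟩ := hF k
      refine ⟨fun w => F (2 * (cc : ℂ) - w), reflected_differentiableOn hF1, ?_, reflected_deriv_norm_le hF1 hF3⟩
      have h := reflected_real_trace (hs := cs * √Γ) (L := Rb * √(Γ * Real.log Γ)) (cc := cc) hF2
      simp only [hX', Function.update_self]
      exact h
    · simp only [hX', Function.update_of_ne hk]; exact hF k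
  have hG' : ∀ k, ∃ G : ℂ → ℂ,
      DifferentiableOn ℂ G {z : ℂ | |z.im| < cs * √Γ ∧ |z.re - c k| < Rb * √(Γ * Real.log Γ) + cs * √Γ} ∧
      (∀ t : ℝ, (t : ℂ) ∈ {z : ℂ | |z.im| < cs * √Γ ∧ |z.re - c k| < Rb * √(Γ * Real.log Γ) + cs * √Γ} →
        G t = ((Aa' k t : ℝ) : ℂ)) ∧
      ∀ z ∈ {z : ℂ | |z.im| < cs * √Γ ∧ |z.re - c k| < Rb * √(Γ * Real.log Γ) + cs * √Γ},
        Aa' k z.re / 2 ≤ (G z).re ∧ ‖G z‖ ≤ 2 * Aa' k z.re := by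
    intro k
    by_cases hk : k = j
    · subst hk
      obtain ⟨G, hG1, hG2, hG3⟩ := hG k
      refine ⟨fun w => G (2 * (cc : ℂ) - w), reflected_differentiableOn hG1, ?_, ?_⟩
      · have h := reflected_area_trace (hs := cs * √Γ) (L := Rb * √(Γ * Real.log Γ)) (cc := cc) hG2
        simp only [hAa', Function.update_self]
        exact h
      · have h := reflected_area_bounds (hs := cs * √Γ) (L := Rb * √(Γ * Real.log Γ)) (cc := cc) hG3
        simp only [hAa', Function.update_self]
        exact h
    · simp only [hAa', Function.update_of_ne hk]; exact hG k
  obtain ⟨U', hU', hU'r, hU'B⟩ := hrc Γ hΓ1 hℓ1 hh₀ hL₀ γ' X' c Aa' u' hu'eq hγ'b hX'h hsep' hca' hA' hF' hG' j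
  -- (3) the left half: `U₂ = U' ∘ (2 c j − ·)`
  have htarget := (biotSavart_target_reversal u X j (2 * cc)).2
  set U₂ : ℂ → (Fin 3 → ℂ) := fun w => U' (2 * (cc : ℂ) - w) with hU₂
  have hleft : ∃ U : ℂ → (Fin 3 → ℂ),
      DifferentiableOn ℂ U {z : ℂ | (|z.im| < cs * √Γ / 4 ∧ |z.re - cc| < Rb * √(Γ * Real.log Γ) + cs * √Γ / 4) ∧ z.re < cc + cs * √Γ / 4} ∧
      (∀ t : ℝ, (t : ℂ) ∈ {z : ℂ | (|z.im| < cs * √Γ / 4 ∧ |z.re - cc| < Rb * √(Γ * Real.log Γ) + cs * √Γ / 4) ∧ z.re < cc + cs * √Γ / 4} →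
        U t = (fun t : ℝ => fun i => ((⟪u X (X j t), EuclideanSpace.single i (1:ℝ)⟫_ℝ : ℝ) : ℂ)) t) ∧
      ∀ z ∈ {z : ℂ | (|z.im| < cs * √Γ / 4 ∧ |z.re - cc| < Rb * √(Γ * Real.log Γ) + cs * √Γ / 4) ∧ z.re < cc + cs * √Γ / 4},
        ‖U z‖ ≤ (∑ k, |Γ * γ k / (4 * Real.pi)|) * (A *
          ((1 + |Real.log (Rb * √(Γ * Real.log Γ) + cs * √Γ / 4)| +
            ((Rb * √(Γ * Real.log Γ) + cs * √Γ / 4) / (cs * √Γ / 4)) ^ 2) / (cs * √Γ / 4) + 1 / (ρ * √Γ))) := by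
    refine ⟨U₂, ?_, ?_, ?_⟩
    · intro w hw
      have hρw := reflect_left_mem_right hw
      have hd : DifferentiableAt ℂ U' (2 * (cc : ℂ) - w) :=
        hU'.differentiableAt (((halves_geometry (cs * √Γ / 4) (Rb * √(Γ * Real.log Γ) + cs * √Γ / 4) cc (cs * √Γ / 4) hh).1).mem_nhds hρw)
      exact (hd.comp w (hasDerivAt_reflect cc w).differentiableAt).differentiableWithinAt
    · intro t ht
      have hρt := reflect_left_mem_right ht
      rw [reflect_ofReal] at hρt
      show U' (2 * (cc : ℂ) - (t : ℂ)) = _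
      rw [reflect_ofReal, hU'r _ hρt]
      have key : u' X' (X' j (2 * cc - t)) = u X (X j t) := by
        have h := htarget (2 * cc - t)
        rw [sub_sub_cancel] at h
        simpa only [hu', hX'] using h
      simp only [key]
    · intro w hw
      have hρw := reflect_left_mem_right hw
      have hb := hU'B _ hρw
      rw [coeff_sum_update_neg] at hb
      exact hb
  -- (4) glue the two halves along the real trace
  have hright : ∃ U : ℂ → (Fin 3 → ℂ),
      DifferentiableOn ℂ U {z : ℂ | (|z.im| < cs * √Γ / 4 ∧ |z.re - cc| < Rb * √(Γ * Real.log Γ) + cs * √Γ / 4) ∧ cc - cs * √Γ / 4 < z.re} ∧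
      (∀ t : ℝ, (t : ℂ) ∈ {z : ℂ | (|z.im| < cs * √Γ / 4 ∧ |z.re - cc| < Rb * √(Γ * Real.log Γ) + cs * √Γ / 4) ∧ cc - cs * √Γ / 4 < z.re} →
        U t = (fun t : ℝ => fun i => ((⟪u X (X j t), EuclideanSpace.single i (1:ℝ)⟫_ℝ : ℝ) : ℂ)) t) ∧
      ∀ z ∈ {z : ℂ | (|z.im| < cs * √Γ / 4 ∧ |z.re - cc| < Rb * √(Γ * Real.log Γ) + cs * √Γ / 4) ∧ cc - cs * √Γ / 4 < z.re},
        ‖U z‖ ≤ (∑ k, |Γ * γ k / (4 * Real.pi)|) * (A *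
          ((1 + |Real.log (Rb * √(Γ * Real.log Γ) + cs * √Γ / 4)| +
            ((Rb * √(Γ * Real.log Γ) + cs * √Γ / 4) / (cs * √Γ / 4)) ^ 2) / (cs * √Γ / 4) + 1 / (ρ * √Γ))) :=
    ⟨U₁, hU₁, hU₁r, hU₁B⟩
  have hδR : cs * √Γ / 4 ≤ Rb * √(Γ * Real.log Γ) + cs * √Γ / 4 := by linarith
  exact glue_stadium_halves hh hh hδR hright hleft

end Summit.NavierStokesRegularity.NavierStokesRegularity.Theorems.StadiumStripPropagationRightHalf
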